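import Literature.Topology.FourManifolds.KhComplexHomotopyProofs
import HarnessLib

/-!
# Gaussian elimination for complexes given by incidence matrices

Sibling file of `KhComplex.lean`, a brick of the invariance programme for
`Literature.Topology.FourManifolds.GaussDiagram.nonempty_iso_khovanovHomology_of_equiv`
(Khovanov (2000), Thm. 1). The cancellations behind the invariance of Khovanov homology under the
second and third Reidemeister moves (Khovanov (2000), §5.3–5.4; Bar-Natan (2002), §4) are
instances of one piece of linear algebra, **Gaussian elimination** (Bar-Natan (2007), Lemma 4.2):
if the matrix of a differential `d` on a based free module `M = B ⊕ D ⊕ C` has an invertible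
block `φ : B → D`, then `(M, d)` retracts by deformation onto `C` with the reduced differential
`ε - γ φ⁻¹ δ`. This file proves it in the form needed downstream, on "total cochains"
(functions on a finite basis, as in `KhComplexHomotopyProofs`), for a block `φ` which is the
identity matrix between two copies of a finite type `X` (the general invertible case is not
needed: the cancelled edges of the Reidemeister moves are bijections of basis states up to signs,
and the signs are first removed by `MHtpy.rescale`):

* `mMap M` — the linear map of a matrix between function spaces; for a square matrix `I`,
  `mMap I` is the total differential of the based complex with matrix `I`
  (`GaussDiagram.totalD = mMap incidence`, `totalD_eq_mMap`);
* `MHtpy I J` — total homotopy data (`F`, `B`, `H` with `d F = F d`, `d B = B d`, `B F = 1`,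
  `F B - 1 = d H + H d`) between the complexes of two square matrices, with `refl`, `trans`
  (composition of strong deformation retractions), `ofEquiv` (relabelling of the basis),
  `rescale` (diagonal change of basis by self-inverse scalars) and `toHtpyData` (the passage to
  `GaussDiagram.HtpyData` of `KhComplexHomotopyProofs`);
* `elim` — **Gaussian elimination**: for a matrix `I` on `X ⊕ (X ⊕ C)` with `d² = 0` whose block
  from the first copy of `X` to the second is the identity, `MHtpy I (redI I)` where
  `redI I r r' = I r r' - ∑ₓ I r (e x) · I (b x) r'` is the reduced matrix on `C`, together with
  `sum_redI_mul_redI` (`d² = 0` for the reduced matrix, so that eliminations can be iterated);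
* `Graded` — bookkeeping of (bi)degrees through all these constructions (`F`, `B` of degree
  `0`, `H` of degree `-1`), feeding the support hypotheses of
  `HtpyData.nonempty_iso_khovanovHomology`.

Everything is proved; no definition of a mathematical object beyond this plumbing and no named
fact is introduced.

## References

* D. Bar-Natan, *Fast Khovanov homology computations*, J. Knot Theory Ramifications 16 (2007)
  243–255, Lemma 4.2 (Gaussian elimination). [cite: BarNatan2007, Lemma 4.2]
* D. Bar-Natan, *On Khovanov's categorification of the Jones polynomial*, Algebr. Geom. Topol. 2
  (2002) 337–370, §4 (the cancellations for `R2`, `R3`). [cite: BarNatan2002, §4]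
* M. Khovanov, *A categorification of the Jones polynomial*, Duke Math. J. 101 (2000) 359–426,
  §5.3–5.4. [cite: Khovanov2000, §5.3]
* C. A. Weibel, *An introduction to homological algebra* (1994), §1.4–1.5 (homotopy
  equivalences, cones). [folklore]
-/

open Function Finset

noncomputable section

namespace Literature.Topology.FourManifolds

namespace KhElim

variable {R : Type} [CommRing R]

/-! ## Linear maps of matrices between function spaces -/

section MMap

variable {S T U : Type}

/-- The linear map `(T → R) → (S → R)` of a matrix `M : T → S → R` on coordinate vectors:
`(mMap M w) s = ∑ₜ M t s · w t` (`M t s` is the coefficient of the basis vector `s` in the image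
of the basis vector `t`). For a square matrix this is the total differential of the based
complex with matrix `M` (cf. `GaussDiagram.totalD`). [folklore] -/
def mMap [Fintype T] (M : T → S → R) : (T → R) →ₗ[R] (S → R) where
  toFun w s := ∑ t, M t s * w t
  map_add' v w := by
    funext s
    simp only [Pi.add_apply, mul_add, Finset.sum_add_distrib]
  map_smul' c v := by
    funext s
    simp only [Pi.smul_apply, smul_eq_mul, RingHom.id_apply, Finset.mul_sum]
    exact Finset.sum_congr rfl fun t _ ↦ by ring

/-- `mMap`, pointwise. [folklore] -/
@[simp]
theorem mMap_apply [Fintype T] (M : T → S → R) (w : T → R) (s : S) :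
    mMap M w s = ∑ t, M t s * w t := rfl

/-- Composition of matrix maps is the matrix map of the product matrix. [folklore] -/
theorem mMap_mMap [Fintype T] [Fintype S] (M : T → S → R) (N : S → U → R) (w : T → R) :
    mMap N (mMap M w) = mMap (fun t u ↦ ∑ s, M t s * N s u) w := by
  funext u
  simp only [mMap_apply, Finset.mul_sum, Finset.sum_mul]
  rw [Finset.sum_comm]
  exact Finset.sum_congr rfl fun t _ ↦ Finset.sum_congr rfl fun s _ ↦ by ring

/-- The matrix map of the identity matrix is the identity. [folklore] -/
theorem mMap_one [Fintype S] [DecidableEq S] (w : S → R) :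
    mMap (fun t s ↦ if t = s then (1 : R) else 0) w = w := by
  funext s
  simp only [mMap_apply, ite_mul, one_mul, zero_mul, Finset.sum_ite_eq', Finset.mem_univ,
    if_true]

/-- The matrix map on a basis vector is the corresponding row of the matrix. [folklore] -/
theorem mMap_single [Fintype T] [DecidableEq T] (M : T → S → R) (t : T) (s : S) :
    mMap M (Pi.single t 1) s = M t s := by
  simp only [mMap_apply, Pi.single_apply, mul_ite, mul_one, mul_zero, Finset.sum_ite_eq',
    Finset.mem_univ, if_true]

/-- Pointwise equal matrices have equal matrix maps. [folklore] -/
theorem mMap_congr [Fintype T] {M M' : T → S → R} (h : ∀ t s, M t s = M' t s) :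
    mMap M = mMap M' := by
  rw [show M = M' from funext fun t ↦ funext fun s ↦ h t s]

end MMap

/-- **The total differential of `KhComplexHomotopyProofs` is the matrix map of the incidence
matrix** (`I a b = ⟨d a, b⟩`, the coefficient of `b` in `d a`). [folklore] -/
theorem totalD_eq_mMap (G : GaussDiagram) (h t : R) :
    G.totalD R h t = mMap (G.incidence R h t) := rfl

/-! ## Total homotopy data between two matrix complexes -/

/-- **Total homotopy data** between the complexes of two square matrices `I` (on the basis `S`)
and `J` (on the basis `T`): linear maps `F : (T → R) → (S → R)`, `B : (S → R) → (T → R)`,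
`H : (S → R) → (S → R)` with `d F = F d`, `d B = B d`, `B F = 1`, `F B - 1 = d H + H d` — a strong
deformation retraction of `(S, I)` onto `(T, J)` (cf. `GaussDiagram.HtpyData`, the case of two
incidence matrices). Bar-Natan (2002), §4; Weibel (1994), §1.4. [cite: BarNatan2002, §4] -/
structure MHtpy {S T : Type} [Fintype S] [Fintype T] (I : S → S → R) (J : T → T → R) where
  /-- The chain map from the small complex to the big one. -/
  F : (T → R) →ₗ[R] (S → R)
  /-- The chain map from the big complex to the small one, left inverse to `F`. -/
  B : (S → R) →ₗ[R] (T → R)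
  /-- The homotopy `F B ≃ 1`. -/
  H : (S → R) →ₗ[R] (S → R)
  /-- `F` is a chain map. -/
  F_comm : ∀ w, mMap I (F w) = F (mMap J w)
  /-- `B` is a chain map. -/
  B_comm : ∀ v, mMap J (B v) = B (mMap I v)
  /-- `B F = 1`. -/
  B_F : ∀ w, B (F w) = w
  /-- `F B - 1 = d H + H d`. -/
  F_B : ∀ v, F (B v) - v = mMap I (H v) + H (mMap I v)

namespace MHtpy

variable {S T U : Type} [Fintype S] [Fintype T] [Fintype U]
  {I : S → S → R} {J : T → T → R} {L : U → U → R}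

variable (I) in
/-- The identity homotopy data. [folklore] -/
def refl : MHtpy I I where
  F := LinearMap.id
  B := LinearMap.id
  H := 0
  F_comm _ := rfl
  B_comm _ := rfl
  B_F _ := rfl
  F_B v := by simp

/-- **Composition of strong deformation retractions**: if `(S, I)` retracts onto `(T, J)` and
`(T, J)` onto `(U, L)`, then `(S, I)` retracts onto `(U, L)`, with `F = F₁ F₂`, `B = B₂ B₁`,
`H = H₁ + F₁ H₂ B₁`. Weibel (1994), §1.4. [folklore] -/
def trans (D₁ : MHtpy I J) (D₂ : MHtpy J L) : MHtpy I L where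
  F := D₁.F ∘ₗ D₂.F
  B := D₂.B ∘ₗ D₁.B
  H := D₁.H + D₁.F ∘ₗ D₂.H ∘ₗ D₁.B
  F_comm w := by
    simp only [LinearMap.comp_apply]
    rw [D₁.F_comm, D₂.F_comm]
  B_comm v := by
    simp only [LinearMap.comp_apply]
    rw [D₂.B_comm, D₁.B_comm]
  B_F w := by
    simp only [LinearMap.comp_apply]
    rw [D₁.B_F, D₂.B_F]
  F_B v := by
    simp only [LinearMap.comp_apply, LinearMap.add_apply, map_add]
    have h1 := D₁.F_B v
    have h2 : D₁.F (D₂.F (D₂.B (D₁.B v))) - D₁.F (D₁.B v) =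
        mMap I (D₁.F (D₂.H (D₁.B v))) + D₁.F (D₂.H (D₁.B (mMap I v))) := by
      rw [← map_sub, D₂.F_B, map_add, D₁.F_comm, D₁.B_comm]
    have h3 : D₁.F (D₂.F (D₂.B (D₁.B v))) - v =
        (D₁.F (D₂.F (D₂.B (D₁.B v))) - D₁.F (D₁.B v)) + (D₁.F (D₁.B v) - v) := by abel
    rw [h3, h2, h1]
    abel

/-- **Relabelling the basis**: if `J a b = I (e a) (e b)` for a bijection `e : T ≃ S`, the two
matrix complexes are isomorphic, in particular homotopy data with `H = 0`. [folklore] -/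
def ofEquiv (e : T ≃ S) (I : S → S → R) (J : T → T → R) (hIJ : ∀ a b, J a b = I (e a) (e b)) :
    MHtpy I J where
  F := { toFun := fun w s ↦ w (e.symm s)
         map_add' := fun _ _ ↦ rfl
         map_smul' := fun _ _ ↦ rfl }
  B := { toFun := fun v t ↦ v (e t)
         map_add' := fun _ _ ↦ rfl
         map_smul' := fun _ _ ↦ rfl }
  H := 0
  F_comm w := by
    funext s'
    simp only [LinearMap.coe_mk, AddHom.coe_mk, mMap_apply]
    rw [← e.sum_comp]
    refine Finset.sum_congr rfl fun t _ ↦ ?_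
    rw [hIJ, e.apply_symm_apply, e.symm_apply_apply]
  B_comm v := by
    funext t'
    simp only [LinearMap.coe_mk, AddHom.coe_mk, mMap_apply]
    rw [← e.sum_comp]
    exact Finset.sum_congr rfl fun t _ ↦ by rw [hIJ]
  B_F w := by
    funext t
    simp only [LinearMap.coe_mk, AddHom.coe_mk, e.symm_apply_apply]
  F_B v := by
    funext s
    simp only [LinearMap.coe_mk, AddHom.coe_mk, e.apply_symm_apply, Pi.sub_apply, sub_self,
      map_zero, LinearMap.zero_apply, Pi.add_apply, Pi.zero_apply, add_zero]

/-- `F` of `ofEquiv`, pointwise. [folklore] -/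
@[simp] theorem ofEquiv_F_apply (e : T ≃ S) (I : S → S → R) (J : T → T → R)
    (hIJ : ∀ a b, J a b = I (e a) (e b)) (w : T → R) (s : S) :
    (ofEquiv e I J hIJ).F w s = w (e.symm s) := rfl

/-- `B` of `ofEquiv`, pointwise. [folklore] -/
@[simp] theorem ofEquiv_B_apply (e : T ≃ S) (I : S → S → R) (J : T → T → R)
    (hIJ : ∀ a b, J a b = I (e a) (e b)) (v : S → R) (t : T) :
    (ofEquiv e I J hIJ).B v t = v (e t) := rfl

/-- `H` of `ofEquiv` vanishes. [folklore] -/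
@[simp] theorem ofEquiv_H (e : T ≃ S) (I : S → S → R) (J : T → T → R)
    (hIJ : ∀ a b, J a b = I (e a) (e b)) : (ofEquiv e I J hIJ).H = 0 := rfl

/-- **Diagonal change of basis by self-inverse scalars** (`u s · u s = 1`, e.g. signs): the
matrix complex of `I` retracts (isomorphically) onto that of `I' a b = u a · I a b · u b`, the
matrix of the same differential in the basis `e'_a = u a · e_a`. Used to normalise a cancelled
block to the identity before `elim`. [folklore] -/
def rescale (I : S → S → R) (u : S → R) (hu : ∀ s, u s * u s = 1) :
    MHtpy I (fun a b ↦ u a * I a b * u b) where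
  F := { toFun := fun w s ↦ u s * w s
         map_add' := fun v w ↦ by funext s; simp only [Pi.add_apply, mul_add]
         map_smul' := fun c v ↦ by
           funext s; simp only [Pi.smul_apply, smul_eq_mul, RingHom.id_apply]; ring }
  B := { toFun := fun v s ↦ u s * v s
         map_add' := fun v w ↦ by funext s; simp only [Pi.add_apply, mul_add]
         map_smul' := fun c v ↦ by
           funext s; simp only [Pi.smul_apply, smul_eq_mul, RingHom.id_apply]; ring }
  H := 0
  F_comm w := by
    funext s'
    simp only [LinearMap.coe_mk, AddHom.coe_mk, mMap_apply, Finset.mul_sum]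
    refine Finset.sum_congr rfl fun s _ ↦ ?_
    have := hu s'
    linear_combination (-(I s s' * u s * w s)) * this
  B_comm v := by
    funext s'
    simp only [LinearMap.coe_mk, AddHom.coe_mk, mMap_apply, Finset.mul_sum]
    refine Finset.sum_congr rfl fun s _ ↦ ?_
    have := hu s
    linear_combination (I s s' * u s' * v s) * this
  B_F w := by
    funext s
    simp only [LinearMap.coe_mk, AddHom.coe_mk, ← mul_assoc, hu, one_mul]
  F_B v := by
    funext s
    simp only [LinearMap.coe_mk, AddHom.coe_mk, ← mul_assoc, hu, one_mul, Pi.sub_apply,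
      sub_self, map_zero, LinearMap.zero_apply, Pi.add_apply, Pi.zero_apply, add_zero]

/-- `F` of `rescale`, pointwise. [folklore] -/
@[simp] theorem rescale_F_apply (I : S → S → R) (u : S → R) (hu : ∀ s, u s * u s = 1)
    (w : S → R) (s : S) : (rescale I u hu).F w s = u s * w s := rfl

/-- `B` of `rescale`, pointwise. [folklore] -/
@[simp] theorem rescale_B_apply (I : S → S → R) (u : S → R) (hu : ∀ s, u s * u s = 1)
    (v : S → R) (s : S) : (rescale I u hu).B v s = u s * v s := rfl

/-- `H` of `rescale` vanishes. [folklore] -/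
@[simp] theorem rescale_H (I : S → S → R) (u : S → R) (hu : ∀ s, u s * u s = 1) :
    (rescale I u hu).H = 0 := rfl

/-- Transport of homotopy data along a pointwise equality of the small matrix. [folklore] -/
def congrRight (D : MHtpy I J) {J' : T → T → R} (hJ : ∀ a b, J a b = J' a b) : MHtpy I J' where
  F := D.F
  B := D.B
  H := D.H
  F_comm w := by rw [← mMap_congr hJ]; exact D.F_comm w
  B_comm v := by rw [← mMap_congr hJ]; exact D.B_comm v
  B_F := D.B_F
  F_B := D.F_B

/-- **From matrix homotopy data to `HtpyData`**: homotopy data between the incidence matrices of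
two Gauss diagrams are homotopy data between their total Khovanov cochains
(`KhComplexHomotopyProofs.HtpyData`). [folklore] -/
def toHtpyData {G K : GaussDiagram} {h t : R}
    (D : MHtpy (K.incidence R h t) (G.incidence R h t)) : GaussDiagram.HtpyData R G K h t where
  F := D.F
  B := D.B
  H := D.H
  F_comm := D.F_comm
  B_comm := D.B_comm
  B_F := D.B_F
  F_B := D.F_B

end MHtpy

/-! ## Degrees -/

section Graded

variable {S T U : Type}

/-- A linear map between function spaces **shifts a (bi)degree by `k`**: the image of the basis
vector `t` is supported on basis vectors `s` with `dS s = dT t + k`. [folklore] -/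
def Graded [DecidableEq T] (dT : T → ℤ × ℤ) (dS : S → ℤ × ℤ) (k : ℤ × ℤ)
    (F : (T → R) →ₗ[R] (S → R)) : Prop :=
  ∀ t s, F (Pi.single t 1) s ≠ 0 → dS s = dT t + k

variable {dT : T → ℤ × ℤ} {dS : S → ℤ × ℤ} {dU : U → ℤ × ℤ}

/-- Expansion of a vector in the standard basis. [folklore] -/
theorem eq_sum_single [Fintype T] [DecidableEq T] (w : T → R) :
    w = ∑ t, w t • (Pi.single t (1 : R) : T → R) := by
  funext t'
  simp only [Finset.sum_apply, Pi.smul_apply, Pi.single_apply, smul_eq_mul, mul_ite, mul_one,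
    mul_zero, Finset.sum_ite_eq, Finset.mem_univ, if_true]

/-- A degree-shifting map sends vectors supported in (bi)degree `g` to vectors supported in
`g + k`. [folklore] -/
theorem Graded.apply_eq_zero [Fintype T] [DecidableEq T] {k : ℤ × ℤ}
    {F : (T → R) →ₗ[R] (S → R)} (hF : Graded dT dS k F) {g : ℤ × ℤ} {w : T → R}
    (hw : ∀ t, dT t ≠ g → w t = 0) {s : S} (hs : dS s ≠ g + k) : F w s = 0 := by
  rw [eq_sum_single w, map_sum, Finset.sum_apply]
  refine Finset.sum_eq_zero fun t _ ↦ ?_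
  rw [map_smul, Pi.smul_apply, smul_eq_mul]
  by_cases ht : dT t = g
  · have : F (Pi.single t 1) s = 0 := by
      by_contra hne
      exact hs (by rw [hF t s hne, ht])
    rw [this, mul_zero]
  · rw [hw t ht, zero_mul]

/-- The homological component only: a map of bidegree `(k₁, k₂)` sends vectors supported in
homological degree `i` to vectors supported in homological degree `i + k₁`. [folklore] -/
theorem Graded.apply_eq_zero_fst [Fintype T] [DecidableEq T] {k : ℤ × ℤ}
    {F : (T → R) →ₗ[R] (S → R)} (hF : Graded dT dS k F) {i : ℤ} {w : T → R}
    (hw : ∀ t, (dT t).1 ≠ i → w t = 0) {s : S} (hs : (dS s).1 ≠ i + k.1) : F w s = 0 := by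
  rw [eq_sum_single w, map_sum, Finset.sum_apply]
  refine Finset.sum_eq_zero fun t _ ↦ ?_
  rw [map_smul, Pi.smul_apply, smul_eq_mul]
  by_cases ht : (dT t).1 = i
  · have : F (Pi.single t 1) s = 0 := by
      by_contra hne
      exact hs (by rw [hF t s hne, Prod.fst_add, ht])
    rw [this, mul_zero]
  · rw [hw t ht, zero_mul]

/-- Composition adds the degree shifts. [folklore] -/
theorem Graded.comp [DecidableEq T] [Fintype S] [DecidableEq S] {k k' : ℤ × ℤ}
    {F : (T → R) →ₗ[R] (S → R)} {F' : (S → R) →ₗ[R] (U → R)}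
    (hF : Graded dT dS k F) (hF' : Graded dS dU k' F') : Graded dT dU (k + k') (F' ∘ₗ F) := by
  intro t u hne
  rw [LinearMap.comp_apply, eq_sum_single (F (Pi.single t 1)), map_sum, Finset.sum_apply] at hne
  obtain ⟨s, -, hs⟩ := Finset.exists_ne_zero_of_sum_ne_zero hne
  rw [map_smul, Pi.smul_apply, smul_eq_mul] at hs
  have h1 : F (Pi.single t 1) s ≠ 0 := fun e ↦ hs (by rw [e, zero_mul])
  have h2 : F' (Pi.single s 1) u ≠ 0 := fun e ↦ hs (by rw [e, mul_zero])
  rw [hF' s u h2, hF t s h1, add_assoc]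

/-- Sums keep the degree shift. [folklore] -/
theorem Graded.add [DecidableEq T] {k : ℤ × ℤ} {F F' : (T → R) →ₗ[R] (S → R)}
    (hF : Graded dT dS k F) (hF' : Graded dT dS k F') : Graded dT dS k (F + F') := by
  intro t s hne
  rw [LinearMap.add_apply, Pi.add_apply] at hne
  by_cases h1 : F (Pi.single t 1) s = 0
  · rw [h1, zero_add] at hne
    exact hF' t s hne
  · exact hF t s h1

/-- The zero map has every degree shift. [folklore] -/
theorem Graded.zero [DecidableEq T] (k : ℤ × ℤ) : Graded dT dS k (0 : (T → R) →ₗ[R] (S → R)) :=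
  fun _ _ hne ↦ (hne rfl).elim

/-- The matrix map of a matrix supported on pairs `(t, s)` with `dS s = dT t + k` has degree
shift `k`. [folklore] -/
theorem Graded.mMap [Fintype T] [DecidableEq T] {k : ℤ × ℤ} {M : T → S → R}
    (hM : ∀ t s, M t s ≠ 0 → dS s = dT t + k) : Graded dT dS k (mMap M) := by
  intro t s hne
  rw [mMap_single] at hne
  exact hM t s hne

/-- The map `F` of `MHtpy.ofEquiv` has degree shift `0` when the bijection preserves
degrees. [folklore] -/
theorem Graded.ofEquiv_F [Fintype S] [Fintype T] [DecidableEq T] (e : T ≃ S) (I : S → S → R)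
    (J : T → T → R) (hIJ : ∀ a b, J a b = I (e a) (e b)) (hd : ∀ t, dS (e t) = dT t) :
    Graded dT dS 0 (MHtpy.ofEquiv e I J hIJ).F := by
  intro t s hne
  rw [MHtpy.ofEquiv_F_apply, Pi.single_apply] at hne
  by_cases h : e.symm s = t
  · have hs : s = e t := by rw [← h, e.apply_symm_apply]
    rw [hs, hd, add_zero]
  · exact (hne (if_neg h)).elim

/-- See `Graded.ofEquiv_F`. [folklore] -/
theorem Graded.ofEquiv_B [Fintype S] [Fintype T] [DecidableEq S] (e : T ≃ S) (I : S → S → R)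
    (J : T → T → R) (hIJ : ∀ a b, J a b = I (e a) (e b)) (hd : ∀ t, dS (e t) = dT t) :
    Graded dS dT 0 (MHtpy.ofEquiv e I J hIJ).B := by
  intro s t hne
  rw [MHtpy.ofEquiv_B_apply, Pi.single_apply] at hne
  by_cases h : e t = s
  · rw [← h, hd, add_zero]
  · exact (hne (if_neg h)).elim

/-- The map `F` of `MHtpy.rescale` has degree shift `0`. [folklore] -/
theorem Graded.rescale_F [Fintype S] [DecidableEq S] (I : S → S → R) (u : S → R)
    (hu : ∀ s, u s * u s = 1) : Graded dS dS 0 (MHtpy.rescale I u hu).F := by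
  intro t s hne
  rw [MHtpy.rescale_F_apply, Pi.single_apply] at hne
  by_cases h : s = t
  · rw [h, add_zero]
  · exact (hne (by rw [if_neg h, mul_zero])).elim

/-- See `Graded.rescale_F`. [folklore] -/
theorem Graded.rescale_B [Fintype S] [DecidableEq S] (I : S → S → R) (u : S → R)
    (hu : ∀ s, u s * u s = 1) : Graded dS dS 0 (MHtpy.rescale I u hu).B := by
  intro t s hne
  rw [MHtpy.rescale_B_apply, Pi.single_apply] at hne
  by_cases h : s = t
  · rw [h, add_zero]
  · exact (hne (by rw [if_neg h, mul_zero])).elim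

end Graded

/-! ## Gaussian elimination -/

section Elim

variable {X C : Type}

/-! ### The matrices of the homotopy equivalence -/

section Mat

variable [DecidableEq C] (I : X ⊕ (X ⊕ C) → X ⊕ (X ⊕ C) → R)

/-- The matrix of the chain map `F : C → M` of Gaussian elimination:
`F(e_r) = e_r - ∑ₓ I r (e x) · e_{b x}`. [cite: BarNatan2007, Lemma 4.2] -/
def matF : C → X ⊕ (X ⊕ C) → R
  | r, .inl x => -I (.inr (.inr r)) (.inr (.inl x))
  | _, .inr (.inl _) => 0
  | r, .inr (.inr r') => if r = r' then 1 else 0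

/-- The matrix of the chain map `B : M → C` of Gaussian elimination: `B(e_r) = e_r`,
`B(e_{e x}) = -∑ᵣ I (b x) r · e_r`, `B(e_{b x}) = 0`. [cite: BarNatan2007, Lemma 4.2] -/
def matB : X ⊕ (X ⊕ C) → C → R
  | .inl _, _ => 0
  | .inr (.inl x), r => -I (.inl x) (.inr (.inr r))
  | .inr (.inr r'), r => if r' = r then 1 else 0

/-- `matF` towards a source of the cancelled block. [folklore] -/
@[simp] theorem matF_inl (r : C) (x : X) :
    matF I r (.inl x) = -I (.inr (.inr r)) (.inr (.inl x)) := rfl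

/-- `matF` towards a target of the cancelled block. [folklore] -/
@[simp] theorem matF_inr_inl (r : C) (x : X) : matF I r (.inr (.inl x)) = 0 := rfl

/-- `matF` towards a kept vector. [folklore] -/
@[simp] theorem matF_inr_inr (r r' : C) :
    matF I r (.inr (.inr r')) = if r = r' then 1 else 0 := rfl

/-- `matB` from a source of the cancelled block. [folklore] -/
@[simp] theorem matB_inl (x : X) (r : C) : matB I (.inl x) r = 0 := rfl

/-- `matB` from a target of the cancelled block. [folklore] -/
@[simp] theorem matB_inr_inl (x : X) (r : C) :
    matB I (.inr (.inl x)) r = -I (.inl x) (.inr (.inr r)) := rfl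

/-- `matB` from a kept vector. [folklore] -/
@[simp] theorem matB_inr_inr (r' r : C) :
    matB I (.inr (.inr r')) r = if r' = r then 1 else 0 := rfl

end Mat

section MatH

variable [DecidableEq X]

variable (R X C) in
/-- The matrix of the homotopy `H : M → M` of Gaussian elimination: `H(e_{e x}) = -e_{b x}` (minus
the inverse of the cancelled identity block), zero elsewhere. [cite: BarNatan2007, Lemma 4.2] -/
def matH : X ⊕ (X ⊕ C) → X ⊕ (X ⊕ C) → R
  | .inr (.inl x), .inl x' => if x = x' then -1 else 0
  | _, _ => 0

/-- `matH` from a target to a source of the cancelled block. [folklore] -/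
@[simp] theorem matH_inr_inl_inl (x x' : X) :
    matH R X C (.inr (.inl x)) (.inl x') = if x = x' then -1 else 0 := rfl

/-- `matH` vanishes on the sources of the cancelled block. [folklore] -/
@[simp] theorem matH_inl (x : X) (s : X ⊕ (X ⊕ C)) : matH R X C (.inl x) s = 0 := rfl

/-- `matH` vanishes on kept vectors. [folklore] -/
@[simp] theorem matH_inr_inr (r : C) (s : X ⊕ (X ⊕ C)) : matH R X C (.inr (.inr r)) s = 0 := rfl

/-- `matH` has no component outside the sources of the cancelled block. [folklore] -/
@[simp] theorem matH_inr_inl_inr (x : X) (s : X ⊕ C) :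
    matH R X C (.inr (.inl x)) (.inr s) = 0 := by
  rcases s with _ | _ <;> rfl

end MatH

section Sq

variable [Fintype X] [Fintype C]

/-- Sums over `X ⊕ (X ⊕ C)` split into three sums. [folklore] -/
theorem sum_sum3 (f : X ⊕ (X ⊕ C) → R) :
    ∑ s, f s = ∑ x, f (.inl x) + ∑ x, f (.inr (.inl x)) + ∑ r, f (.inr (.inr r)) := by
  rw [Fintype.sum_sum_type, Fintype.sum_sum_type, add_assoc]

variable (I : X ⊕ (X ⊕ C) → X ⊕ (X ⊕ C) → R)

/-- **The reduced matrix** of Gaussian elimination on the kept part `C` of the basis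
`X ⊕ (X ⊕ C)` (first copy of `X`: the sources `b x` of the cancelled identity block; second
copy: its targets `e x`): `I' r r' = I r r' - ∑ₓ I r (e x) · I (b x) r'`, i.e. `ε - γ φ⁻¹ δ` with
`φ = 1`. Bar-Natan (2007), Lemma 4.2. [cite: BarNatan2007, Lemma 4.2] -/
def redI (r r' : C) : R :=
  I (.inr (.inr r)) (.inr (.inr r')) -
    ∑ x, I (.inr (.inr r)) (.inr (.inl x)) * I (.inl x) (.inr (.inr r'))

variable {I}
variable (h2 : ∀ a z, ∑ y, I a y * I y z = 0)

/-! ### The components of `d² = 0` through the cancelled block -/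

include h2 in
/-- `d² = 0` between kept vectors. [folklore] -/
theorem sq_cc (r r' : C) :
    ∑ r₁, I (.inr (.inr r)) (.inr (.inr r₁)) * I (.inr (.inr r₁)) (.inr (.inr r')) =
      -(∑ x, I (.inr (.inr r)) (.inl x) * I (.inl x) (.inr (.inr r'))) -
        ∑ x, I (.inr (.inr r)) (.inr (.inl x)) * I (.inr (.inl x)) (.inr (.inr r')) := by
  have E := h2 (.inr (.inr r)) (.inr (.inr r'))
  rw [sum_sum3] at E
  linear_combination E

section BF

variable [DecidableEq C]

/-- `B F = 1` as a matrix identity. [cite: BarNatan2007, Lemma 4.2] -/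
theorem elim_B_F_mat (r r' : C) :
    ∑ s, matF I r s * matB I s r' = if r = r' then 1 else 0 := by
  rw [sum_sum3]
  simp only [matB_inl, mul_zero, Finset.sum_const_zero, zero_add, matF_inr_inl, zero_mul,
    matF_inr_inr, matB_inr_inr, ite_mul, one_mul, Finset.sum_ite_eq, Finset.mem_univ, if_true]

end BF

variable [DecidableEq X] (hφ : ∀ x x', I (.inl x) (.inr (.inl x')) = if x = x' then 1 else 0)

include h2 hφ in
/-- `d² = 0` from a kept vector to a target of the cancelled block. [folklore] -/
theorem sq_ce (r : C) (x' : X) :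
    ∑ r₁, I (.inr (.inr r)) (.inr (.inr r₁)) * I (.inr (.inr r₁)) (.inr (.inl x')) =
      -I (.inr (.inr r)) (.inl x') -
        ∑ x, I (.inr (.inr r)) (.inr (.inl x)) * I (.inr (.inl x)) (.inr (.inl x')) := by
  have E := h2 (.inr (.inr r)) (.inr (.inl x'))
  rw [sum_sum3] at E
  simp only [hφ, mul_ite, mul_one, mul_zero, Finset.sum_ite_eq', Finset.mem_univ, if_true] at E
  linear_combination E

include h2 hφ in
/-- `d² = 0` from a source to a target of the cancelled block. [folklore] -/
theorem sq_be (x x' : X) :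
    ∑ r₁, I (.inl x) (.inr (.inr r₁)) * I (.inr (.inr r₁)) (.inr (.inl x')) =
      -I (.inl x) (.inl x') - I (.inr (.inl x)) (.inr (.inl x')) := by
  have E := h2 (.inl x) (.inr (.inl x'))
  rw [sum_sum3] at E
  simp only [hφ, mul_ite, mul_one, mul_zero, ite_mul, one_mul, zero_mul, Finset.sum_ite_eq,
    Finset.sum_ite_eq', Finset.mem_univ, if_true] at E
  linear_combination E

include h2 hφ in
/-- `d² = 0` from a source of the cancelled block to a kept vector. [folklore] -/
theorem sq_bc (x : X) (r' : C) :
    ∑ r₁, I (.inl x) (.inr (.inr r₁)) * I (.inr (.inr r₁)) (.inr (.inr r')) =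
      -(∑ x₁, I (.inl x) (.inl x₁) * I (.inl x₁) (.inr (.inr r'))) -
        I (.inr (.inl x)) (.inr (.inr r')) := by
  have E := h2 (.inl x) (.inr (.inr r'))
  rw [sum_sum3] at E
  simp only [hφ, ite_mul, one_mul, zero_mul, Finset.sum_ite_eq, Finset.mem_univ, if_true] at E
  linear_combination E

include h2 hφ in
/-- **`d² = 0` for the reduced matrix** (so that Gaussian eliminations can be iterated).
[cite: BarNatan2007, Lemma 4.2] -/
theorem sum_redI_mul_redI (r r' : C) : ∑ r₁, redI I r r₁ * redI I r₁ r' = 0 := by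
  -- the four terms of the expansion
  have T1 := sq_cc h2 r r'
  have T2 : ∑ r₁, I (.inr (.inr r)) (.inr (.inr r₁)) *
      ∑ x, I (.inr (.inr r₁)) (.inr (.inl x)) * I (.inl x) (.inr (.inr r')) =
      ∑ x, (-I (.inr (.inr r)) (.inl x) -
        ∑ x₂, I (.inr (.inr r)) (.inr (.inl x₂)) * I (.inr (.inl x₂)) (.inr (.inl x))) *
        I (.inl x) (.inr (.inr r')) := by
    simp only [Finset.mul_sum]
    rw [Finset.sum_comm]
    refine Finset.sum_congr rfl fun x _ ↦ ?_
    rw [← sq_ce h2 hφ r x, Finset.sum_mul]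
    exact Finset.sum_congr rfl fun r₁ _ ↦ by ring
  have T3 : ∑ r₁, (∑ x, I (.inr (.inr r)) (.inr (.inl x)) * I (.inl x) (.inr (.inr r₁))) *
      I (.inr (.inr r₁)) (.inr (.inr r')) =
      ∑ x, I (.inr (.inr r)) (.inr (.inl x)) *
        (-(∑ x₁, I (.inl x) (.inl x₁) * I (.inl x₁) (.inr (.inr r'))) -
          I (.inr (.inl x)) (.inr (.inr r'))) := by
    simp only [Finset.sum_mul]
    rw [Finset.sum_comm]
    refine Finset.sum_congr rfl fun x _ ↦ ?_
    rw [← sq_bc h2 hφ x r', Finset.mul_sum]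
    exact Finset.sum_congr rfl fun r₁ _ ↦ by ring
  have T4 : ∑ r₁, (∑ x, I (.inr (.inr r)) (.inr (.inl x)) * I (.inl x) (.inr (.inr r₁))) *
      ∑ x', I (.inr (.inr r₁)) (.inr (.inl x')) * I (.inl x') (.inr (.inr r')) =
      ∑ x, ∑ x', I (.inr (.inr r)) (.inr (.inl x)) *
        (-I (.inl x) (.inl x') - I (.inr (.inl x)) (.inr (.inl x'))) *
          I (.inl x') (.inr (.inr r')) := by
    have : ∀ r₁, (∑ x, I (.inr (.inr r)) (.inr (.inl x)) * I (.inl x) (.inr (.inr r₁))) *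
        ∑ x', I (.inr (.inr r₁)) (.inr (.inl x')) * I (.inl x') (.inr (.inr r')) =
        ∑ x, ∑ x', I (.inr (.inr r)) (.inr (.inl x)) * I (.inl x') (.inr (.inr r')) *
          (I (.inl x) (.inr (.inr r₁)) * I (.inr (.inr r₁)) (.inr (.inl x'))) := by
      intro r₁
      rw [Finset.sum_mul_sum]
      exact Finset.sum_congr rfl fun x _ ↦ Finset.sum_congr rfl fun x' _ ↦ by ring
    simp only [this]
    rw [Finset.sum_comm]
    refine Finset.sum_congr rfl fun x _ ↦ ?_
    rw [Finset.sum_comm]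
    refine Finset.sum_congr rfl fun x' _ ↦ ?_
    rw [← Finset.mul_sum, sq_be h2 hφ x x']
    ring
  -- expand the product of differences and substitute
  have expand : ∑ r₁, redI I r r₁ * redI I r₁ r' =
      ∑ r₁, I (.inr (.inr r)) (.inr (.inr r₁)) * I (.inr (.inr r₁)) (.inr (.inr r')) -
      ∑ r₁, I (.inr (.inr r)) (.inr (.inr r₁)) *
        ∑ x, I (.inr (.inr r₁)) (.inr (.inl x)) * I (.inl x) (.inr (.inr r')) -
      ∑ r₁, (∑ x, I (.inr (.inr r)) (.inr (.inl x)) * I (.inl x) (.inr (.inr r₁))) *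
        I (.inr (.inr r₁)) (.inr (.inr r')) +
      ∑ r₁, (∑ x, I (.inr (.inr r)) (.inr (.inl x)) * I (.inl x) (.inr (.inr r₁))) *
        ∑ x', I (.inr (.inr r₁)) (.inr (.inl x')) * I (.inl x') (.inr (.inr r')) := by
    simp only [redI, ← Finset.sum_sub_distrib, ← Finset.sum_add_distrib]
    exact Finset.sum_congr rfl fun r₁ _ ↦ by ring
  rw [expand, T1, T2, T3, T4]
  -- everything is now a sum over `x` (and `x'`); normalise
  have e3 : ∑ x, I (.inr (.inr r)) (.inr (.inl x)) *
      (-(∑ x₁, I (.inl x) (.inl x₁) * I (.inl x₁) (.inr (.inr r'))) -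
        I (.inr (.inl x)) (.inr (.inr r'))) =
      -(∑ x, ∑ x', I (.inr (.inr r)) (.inr (.inl x)) * I (.inl x) (.inl x') *
        I (.inl x') (.inr (.inr r'))) -
      ∑ x, I (.inr (.inr r)) (.inr (.inl x)) * I (.inr (.inl x)) (.inr (.inr r')) := by
    rw [← Finset.sum_neg_distrib, ← Finset.sum_sub_distrib]
    refine Finset.sum_congr rfl fun x _ ↦ ?_
    rw [mul_sub, mul_neg, Finset.mul_sum]
    congr 2
    exact Finset.sum_congr rfl fun x' _ ↦ by ring
  have e2 : ∑ x, (-I (.inr (.inr r)) (.inl x) -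
      ∑ x₂, I (.inr (.inr r)) (.inr (.inl x₂)) * I (.inr (.inl x₂)) (.inr (.inl x))) *
        I (.inl x) (.inr (.inr r')) =
      -(∑ x, I (.inr (.inr r)) (.inl x) * I (.inl x) (.inr (.inr r'))) -
      ∑ x, ∑ x', I (.inr (.inr r)) (.inr (.inl x)) * I (.inr (.inl x)) (.inr (.inl x')) *
        I (.inl x') (.inr (.inr r')) := by
    rw [Finset.sum_comm, ← Finset.sum_neg_distrib, ← Finset.sum_sub_distrib]
    refine Finset.sum_congr rfl fun x _ ↦ ?_
    rw [sub_mul, neg_mul, Finset.sum_mul]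
  have e4 : ∑ x, ∑ x', I (.inr (.inr r)) (.inr (.inl x)) *
      (-I (.inl x) (.inl x') - I (.inr (.inl x)) (.inr (.inl x'))) *
        I (.inl x') (.inr (.inr r')) =
      -(∑ x, ∑ x', I (.inr (.inr r)) (.inr (.inl x)) * I (.inl x) (.inl x') *
        I (.inl x') (.inr (.inr r'))) -
      ∑ x, ∑ x', I (.inr (.inr r)) (.inr (.inl x)) * I (.inr (.inl x)) (.inr (.inl x')) *
        I (.inl x') (.inr (.inr r')) := by
    rw [← Finset.sum_neg_distrib, ← Finset.sum_sub_distrib]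
    refine Finset.sum_congr rfl fun x _ ↦ ?_
    rw [← Finset.sum_neg_distrib, ← Finset.sum_sub_distrib]
    exact Finset.sum_congr rfl fun x' _ ↦ by ring
  rw [e2, e3, e4]
  ring

section WithC

variable [DecidableEq C]

/-! ### The identities of Gaussian elimination, as matrix identities -/

include h2 hφ in
/-- `d F = F d'` as a matrix identity. [cite: BarNatan2007, Lemma 4.2] -/
theorem elim_F_comm_mat (r : C) (s' : X ⊕ (X ⊕ C)) :
    ∑ s, matF I r s * I s s' = ∑ r', redI I r r' * matF I r' s' := by
  rw [sum_sum3]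
  simp only [matF_inl, matF_inr_inl, zero_mul, Finset.sum_const_zero, add_zero, matF_inr_inr,
    ite_mul, one_mul, Finset.sum_ite_eq, Finset.mem_univ, if_true]
  rcases s' with x' | x' | r''
  · -- towards a source of the cancelled block: uses `sq_ce`, `sq_be`
    simp only [matF_inl, neg_mul, Finset.sum_neg_distrib, mul_neg]
    have key : ∑ r', redI I r r' * I (.inr (.inr r')) (.inr (.inl x')) =
        -I (.inr (.inr r)) (.inl x') +
          ∑ x, I (.inr (.inr r)) (.inr (.inl x)) * I (.inl x) (.inl x') := by
      have step : ∑ r', redI I r r' * I (.inr (.inr r')) (.inr (.inl x')) =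
          ∑ r', I (.inr (.inr r)) (.inr (.inr r')) * I (.inr (.inr r')) (.inr (.inl x')) -
          ∑ x, I (.inr (.inr r)) (.inr (.inl x)) *
            ∑ r', I (.inl x) (.inr (.inr r')) * I (.inr (.inr r')) (.inr (.inl x')) := by
        simp only [redI, sub_mul, Finset.sum_sub_distrib, Finset.sum_mul, Finset.mul_sum]
        congr 1
        rw [Finset.sum_comm]
        exact Finset.sum_congr rfl fun x _ ↦ Finset.sum_congr rfl fun r' _ ↦ by ring
      rw [step, sq_ce h2 hφ r x']
      simp only [sq_be h2 hφ]
      rw [show ∑ x, I (.inr (.inr r)) (.inr (.inl x)) *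
          (-I (.inl x) (.inl x') - I (.inr (.inl x)) (.inr (.inl x'))) =
          -(∑ x, I (.inr (.inr r)) (.inr (.inl x)) * I (.inl x) (.inl x')) -
            ∑ x, I (.inr (.inr r)) (.inr (.inl x)) * I (.inr (.inl x)) (.inr (.inl x')) from by
        rw [← Finset.sum_neg_distrib, ← Finset.sum_sub_distrib]
        exact Finset.sum_congr rfl fun x _ ↦ by ring]
      ring
    rw [key]
    ring
  · -- towards a target of the cancelled block: both sides vanish
    simp only [matF_inr_inl, mul_zero, Finset.sum_const_zero, hφ, mul_ite, mul_one,
      Finset.sum_ite_eq', Finset.mem_univ, if_true, neg_add_cancel]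
  · -- towards a kept vector: the definition of the reduced matrix
    simp only [matF_inr_inr, mul_ite, mul_one, mul_zero, Finset.sum_ite_eq', Finset.mem_univ,
      if_true, redI, neg_mul, Finset.sum_neg_distrib]
    ring

include h2 hφ in
/-- `d' B = B d` as a matrix identity. [cite: BarNatan2007, Lemma 4.2] -/
theorem elim_B_comm_mat (s : X ⊕ (X ⊕ C)) (r' : C) :
    ∑ r, matB I s r * redI I r r' = ∑ s', I s s' * matB I s' r' := by
  rw [sum_sum3 (fun s' ↦ I s s' * matB I s' r')]
  simp only [matB_inl, mul_zero, Finset.sum_const_zero, zero_add, matB_inr_inl, matB_inr_inr,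
    mul_ite, mul_one, Finset.sum_ite_eq', Finset.mem_univ, if_true]
  rcases s with x₁ | x₁ | r₁
  · -- from a source of the cancelled block: both sides vanish
    simp only [matB_inl, zero_mul, Finset.sum_const_zero, hφ, ite_mul, one_mul,
      Finset.sum_neg_distrib, Finset.sum_ite_eq, Finset.mem_univ, if_true, mul_neg,
      neg_add_cancel]
  · -- from a target of the cancelled block: uses `sq_bc`, `sq_be`
    simp only [matB_inr_inl, neg_mul, Finset.sum_neg_distrib, mul_neg]
    have key : ∑ r, I (.inl x₁) (.inr (.inr r)) * redI I r r' =
        -I (.inr (.inl x₁)) (.inr (.inr r')) +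
          ∑ x, I (.inr (.inl x₁)) (.inr (.inl x)) * I (.inl x) (.inr (.inr r')) := by
      have step : ∑ r, I (.inl x₁) (.inr (.inr r)) * redI I r r' =
          ∑ r, I (.inl x₁) (.inr (.inr r)) * I (.inr (.inr r)) (.inr (.inr r')) -
          ∑ x, (∑ r, I (.inl x₁) (.inr (.inr r)) * I (.inr (.inr r)) (.inr (.inl x))) *
            I (.inl x) (.inr (.inr r')) := by
        simp only [redI, mul_sub, Finset.sum_sub_distrib, Finset.mul_sum, Finset.sum_mul]
        congr 1
        rw [Finset.sum_comm]
        exact Finset.sum_congr rfl fun x _ ↦ Finset.sum_congr rfl fun r _ ↦ by ring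
      rw [step, sq_bc h2 hφ x₁ r']
      simp only [sq_be h2 hφ x₁]
      rw [show ∑ x, (-I (.inl x₁) (.inl x) - I (.inr (.inl x₁)) (.inr (.inl x))) *
          I (.inl x) (.inr (.inr r')) =
          -(∑ x, I (.inl x₁) (.inl x) * I (.inl x) (.inr (.inr r'))) -
            ∑ x, I (.inr (.inl x₁)) (.inr (.inl x)) * I (.inl x) (.inr (.inr r')) from by
        rw [← Finset.sum_neg_distrib, ← Finset.sum_sub_distrib]
        exact Finset.sum_congr rfl fun x _ ↦ by ring]
      ring
    rw [key]
    ring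
  · -- from a kept vector: the definition of the reduced matrix
    simp only [matB_inr_inr, ite_mul, one_mul, zero_mul, Finset.sum_ite_eq, Finset.mem_univ,
      if_true, redI, mul_neg, Finset.sum_neg_distrib]
    ring

include h2 hφ in
/-- `F B - 1 = d H + H d` as a matrix identity. [cite: BarNatan2007, Lemma 4.2] -/
theorem elim_F_B_mat (s s' : X ⊕ (X ⊕ C)) :
    ∑ r, matB I s r * matF I r s' - (if s = s' then 1 else 0) =
      ∑ u, matH R X C s u * I u s' + ∑ u, I s u * matH R X C u s' := by
  rcases s with x₁ | x₁ | r₁ <;> rcases s' with x' | x' | r' <;>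
    simp only [sum_sum3, matB_inl, matB_inr_inl, matB_inr_inr, matF_inl, matF_inr_inl,
      matF_inr_inr, matH_inl, matH_inr_inr, matH_inr_inl_inl, matH_inr_inl_inr, hφ, zero_mul,
      mul_zero, mul_one, one_mul, mul_neg, neg_mul, neg_neg, ite_mul, mul_ite,
      Finset.sum_const_zero, Finset.sum_neg_distrib, Finset.sum_ite_eq, Finset.sum_ite_eq',
      Finset.mem_univ, if_true, add_zero, zero_add, sub_zero, zero_sub, reduceCtorEq, if_false,
      Sum.inl.injEq, Sum.inr.injEq] <;>
    (try rw [sq_be h2 hφ]) <;> (try split_ifs) <;> ring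

/-! ### The homotopy data of Gaussian elimination -/

/-- **Gaussian elimination** (Bar-Natan (2007), Lemma 4.2, ungraded form with all internal
blocks allowed): if the square matrix `I` on the basis `X ⊕ (X ⊕ C)` satisfies `d² = 0` and
its block from the first copy of `X` to the second is the identity matrix, then the matrix
complex of `I` retracts by a strong deformation retraction onto the kept part `C` with the
reduced matrix `redI I` (`ε - γ φ⁻¹ δ`): `F(e_r) = e_r - ∑ₓ I r (e x) e_{b x}`,
`B(e_r) = e_r`, `B(e_{e x}) = -∑ᵣ I (b x) r e_r`, `B(e_{b x}) = 0`, `H(e_{e x}) = -e_{b x}`.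
[cite: BarNatan2007, Lemma 4.2] -/
def elim : MHtpy I (redI I) where
  F := mMap (matF I)
  B := mMap (matB I)
  H := mMap (matH R X C)
  F_comm w := by
    rw [mMap_mMap, mMap_mMap]
    exact congrFun (congrArg _ (mMap_congr fun r s' ↦ elim_F_comm_mat h2 hφ r s')) w
  B_comm v := by
    rw [mMap_mMap, mMap_mMap]
    exact congrFun (congrArg _ (mMap_congr fun s r' ↦ elim_B_comm_mat h2 hφ s r')) v
  B_F w := by
    rw [mMap_mMap, mMap_congr fun r r' ↦ elim_B_F_mat (I := I) r r', mMap_one]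
  F_B v := by
    rw [mMap_mMap, mMap_mMap, mMap_mMap]
    funext s'
    simp only [Pi.sub_apply, Pi.add_apply, mMap_apply]
    have h1 : v s' = ∑ s, (if s = s' then (1 : R) else 0) * v s := by
      simp only [ite_mul, one_mul, zero_mul, Finset.sum_ite_eq', Finset.mem_univ, if_true]
    rw [h1, ← Finset.sum_sub_distrib, ← Finset.sum_add_distrib]
    refine Finset.sum_congr rfl fun s _ ↦ ?_
    rw [← sub_mul, elim_F_B_mat h2 hφ s s', add_mul]

/-- The chain map `F` of Gaussian elimination is the matrix map of `matF`. [folklore] -/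
@[simp] theorem elim_F : (elim h2 hφ).F = mMap (matF I) := rfl

/-- The chain map `B` of Gaussian elimination is the matrix map of `matB`. [folklore] -/
@[simp] theorem elim_B : (elim h2 hφ).B = mMap (matB I) := rfl

/-- The homotopy `H` of Gaussian elimination is the matrix map of `matH`. [folklore] -/
@[simp] theorem elim_H : (elim h2 hφ).H = mMap (matH R X C) := rfl

/-! ### Degrees through Gaussian elimination -/

variable {dM : X ⊕ (X ⊕ C) → ℤ × ℤ}
  (hI : ∀ a b, I a b ≠ 0 → dM b = dM a + (1, 0))
  (hbe : ∀ x, dM (.inr (.inl x)) = dM (.inl x) + (1, 0))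

include hI hbe in
omit [Fintype X] [DecidableEq X] in
/-- `F` has degree `0` (for the degree of `C` induced from `M`). [folklore] -/
theorem graded_elim_F :
    Graded (fun r ↦ dM (.inr (.inr r))) dM 0 (mMap (R := R) (matF I)) := by
  refine Graded.mMap fun r s hne ↦ ?_
  rcases s with x | x | r'
  · rw [matF_inl, neg_ne_zero] at hne
    have h1 := hI _ _ hne
    rw [hbe] at h1
    rw [add_zero]
    exact add_right_cancel h1
  · exact (hne rfl).elim
  · rw [matF_inr_inr] at hne
    by_cases h : r = r'
    · rw [h, add_zero]
    · exact (hne (if_neg h)).elim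

include hI hbe in
/-- `B` has degree `0`. [folklore] -/
theorem graded_elim_B :
    Graded dM (fun r ↦ dM (.inr (.inr r))) 0 (mMap (R := R) (matB I)) := by
  refine Graded.mMap fun s r hne ↦ ?_
  rcases s with x | x | r'
  · exact (hne rfl).elim
  · rw [matB_inr_inl, neg_ne_zero] at hne
    rw [hI _ _ hne, hbe, add_zero]
  · rw [matB_inr_inr] at hne
    by_cases h : r' = r
    · rw [h, add_zero]
    · exact (hne (if_neg h)).elim

include hbe in
/-- `H` has degree `-1`. [folklore] -/
theorem graded_elim_H : Graded dM dM (-1, 0) (mMap (matH R X C)) := by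
  refine Graded.mMap fun s s' hne ↦ ?_
  rcases s with x | x | r
  · exact (hne rfl).elim
  · rcases s' with x' | s'
    · rw [matH_inr_inl_inl] at hne
      by_cases h : x = x'
      · rw [← h, hbe, add_assoc, Prod.mk_add_mk]
        norm_num
      · exact (hne (if_neg h)).elim
    · exact (hne (matH_inr_inl_inr x s')).elim
  · exact (hne rfl).elim

end WithC

end Sq

end Elim

end KhElim

end Literature.Topology.FourManifolds
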